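import Mathlib
import Summits.Ventures.PercRepro2.HCov
import Summits.Ventures.PercRepro2.RootLeafUHalf
import Summits.Ventures.PercRepro2.RootLeafUTheorem
import Summits.Ventures.PercRepro2.RootLeafUPocketFacts
import Summits.Ventures.PercRepro2.RootLeafUPocketFactsO1
import Summits.Ventures.PercRepro2.RootLeafUPocketJointConv
import Summits.Ventures.PercRepro2.RootLeafUPocketJointCellsL
import Summits.Ventures.PercRepro2.RootLeafUPocketJointCellsL2
import Summits.Ventures.PercRepro2.RootLeafUPocketXbPDOFull
import Summits.Ventures.PercRepro2.RootLeafUPocketB1Cert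
import Summits.Ventures.PercRepro2.RootLeafUMasterIdentity

/-!
# The o-pocket class CLOSED: `B1 ≥ 0`, `0 ≤ T2oL`, `0 ≤ T2` and the (G4-u) induction step on every
boundary-`{u, a₂, o}` pocket (blind cell PercRepro2, p4 g24; S3 (G4-u), proofs/P4-G24-OPOCKETL-MASTER.md §6–§7;
no definitions; generated text — work/gen/gen_pocketb1.py)

For a pocket `P ∋ b` with terminals `u, a₂, o` and the outside vertex `c` (the hypotheses of
`PocketJoint.T2oK_nonneg_pocketO`, the `o ∈ K` half of S3 (ai)):

* **`B1_nonneg_pocketO`**: `0 ≤ t·P(T, oL, bL) − P(T, oL)·P(T, bL)` — the four masses factored by the outside type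
  (`jcells_TL`, `jcells_TL_oL`, `jcells_TL_bL`, `jcells_TL_oL_bL`, atoms in the `∧` form through `convI_*` / `convO_*`), then the
  abstract certificate `PocketL.B1_cert` fed with the three pocket facts `factO_4` (BHK06 1.3), `factO_0`, `factO_6`
  (BHK06 1.4) of the pocket copy at `c := o`;
* **`T2oL_nonneg_pocketO`**: `0 ≤ T2oL` — the every-instance reduction `LMaster.T2oL_nonneg_of_B1` (master identity,
  claims (i) and (iii), BHK06 1.4 on `R`, `(OU) ≥ 0`) with `B1 ≥ 0`;
* **`T2_nonneg_pocketO`**: W1 = `0 ≤ T2` on the class, with the `o ∈ K` half `T2oK_nonneg_pocketO`;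
* **`HCov_root_leaf_u_pocketO`**: (HCOV) at `(o, a₁, a₂, c, b)` for `a₁` pendant at the unmarked `u` follows from (HCOV)
  at `(o, u, a₂, c, b)` on the whole boundary-`{u, a₂, o}` pocket class — every leaf weight, every weight vector, no
  hypothesis left (the 181 harvest lines of the o-pocket class of S3 (ah)).
-/

namespace Summit.Ventures.PercRepro2

open UnionCluster CovForm

namespace RootLeafU

namespace PocketJoint

variable {V : Type*} {E : Type*} [Fintype E] [DecidableEq E] [Fintype V] [DecidableEq V] {R : Type*} [Field R] [LinearOrder R] [IsStrictOrderedRing R] (p : E → R)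
variable {ends : E → Sym2 V} {P : Set V} {o u a₂ c b : V} {off inn : Config E → Config E}

set_option maxHeartbeats 4000000 in
set_option maxRecDepth 100000 in
/-- **`B1 ≥ 0` on every boundary-`{u, a₂, o}` pocket**: given `T`, the events `o ∈ C_u` and `b ∈ C_u` are positively
correlated (the one pocket-class input of the master identity route). -/
theorem B1_nonneg_pocketO (hp : IsProbVec p)
    (hP : ∀ e y z, ends e = s(y, z) → y ∈ P → z ∈ P ∨ z = u ∨ z = a₂ ∨ z = o)
    (hoff : (∀ ω e, e ∈ touches ends P → off ω e = false) ∧ (∀ ω e, e ∉ touches ends P → off ω e = ω e))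
    (hinn : (∀ ω e, e ∈ touches ends P → inn ω e = ω e) ∧ (∀ ω e, e ∉ touches ends P → inn ω e = false))
    (hu : u ∉ P) (ha : a₂ ∉ P) (ho : o ∉ P) (hc : c ∉ P) (hb : b ∈ P) :
    0 ≤ prob p (TEvent ends u a₂ c) * prob p (TEvent ends u a₂ c ∩ (connEvent ends u o ∩ connEvent ends u b)) - prob p (TEvent ends u a₂ c ∩ connEvent ends u o) * prob p (TEvent ends u a₂ c ∩ connEvent ends u b) := by
  have f13 := PocketBridge.factO_4 p hp hinn (u := u) (a₂ := a₂) (c := o) (b := b)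
  have f14 := PocketBridge.factO_0 p hp hinn (u := u) (a₂ := a₂) (c := o) (b := b)
  have f14H := PocketBridge.factO_6 p hp hinn (u := u) (a₂ := a₂) (c := o) (b := b)
  rw [jcells_TL p hP hoff hinn hu ha ho hc hb, jcells_TL_oL p hP hoff hinn hu ha ho hc hb,
    jcells_TL_bL p hP hoff hinn hu ha ho hc hb, jcells_TL_oL_bL p hP hoff hinn hu ha ho hc hb]
  simp only [convI_1, convI_3, convI_4, convI_6, convI_7, convI_8, convI_10, convI_12, convI_13, convI_14]
  refine PocketL.B1_cert _ _ _ _ _ _ _ _ _ _ _ _ _ _ ?_ ?_ ?_ ?_ ?_ ?_ ?_ ?_ ?_ ?_ ?_ ?_ ?_ ?_ f13 f14 f14H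
  all_goals exact prob_nonneg hp _

/-- **`0 ≤ T2oL` on every boundary-`{u, a₂, o}` pocket** — the `o ∈ L` half of W1 on the 181-line class. -/
theorem T2oL_nonneg_pocketO (hp : IsProbVec p)
    (hP : ∀ e y z, ends e = s(y, z) → y ∈ P → z ∈ P ∨ z = u ∨ z = a₂ ∨ z = o)
    (hoff : (∀ ω e, e ∈ touches ends P → off ω e = false) ∧ (∀ ω e, e ∉ touches ends P → off ω e = ω e))
    (hinn : (∀ ω e, e ∈ touches ends P → inn ω e = ω e) ∧ (∀ ω e, e ∉ touches ends P → inn ω e = false))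
    (hu : u ∉ P) (ha : a₂ ∉ P) (ho : o ∉ P) (hc : c ∉ P) (hb : b ∈ P) :
    0 ≤ T2oL p ends o a₂ c b u :=
  LMaster.T2oL_nonneg_of_B1 p ends o a₂ c b u hp (B1_nonneg_pocketO p hp hP hoff hinn hu ha ho hc hb)

/-- **W1 on every boundary-`{u, a₂, o}` pocket**: `0 ≤ T2`, unconditional. -/
theorem T2_nonneg_pocketO (hp : IsProbVec p)
    (hP : ∀ e y z, ends e = s(y, z) → y ∈ P → z ∈ P ∨ z = u ∨ z = a₂ ∨ z = o)
    (hoff : (∀ ω e, e ∈ touches ends P → off ω e = false) ∧ (∀ ω e, e ∉ touches ends P → off ω e = ω e))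
    (hinn : (∀ ω e, e ∈ touches ends P → inn ω e = ω e) ∧ (∀ ω e, e ∉ touches ends P → inn ω e = false))
    (hu : u ∉ P) (ha : a₂ ∉ P) (ho : o ∉ P) (hc : c ∉ P) (hb : b ∈ P) :
    0 ≤ T2 p ends o a₂ c b u :=
  T2_nonneg_of_halves p ends o a₂ c b u (T2oL_nonneg_pocketO p hp hP hoff hinn hu ha ho hc hb)
    (T2oK_nonneg_pocketO p hp hP hoff hinn hu ha ho hc hb _ _ _ _ _ _ _ _ _ _ rfl rfl rfl rfl rfl rfl rfl rfl rfl rfl)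

/-- **(G4-u) on the whole boundary-`{u, a₂, o}` pocket class, unconditional**: (HCOV) for a root `a₁` pendant at the
unmarked `u` follows from (HCOV) at the smaller instance `(o, u, a₂, c, b)` whenever `b` lies in a pocket `P` with
`o, u, a₂, c ∉ P` whose edges all end in `P ∪ {u, a₂, o}` — every leaf weight, every weight vector. -/
theorem HCov_root_leaf_u_pocketO {f : E} {a₁ : V} (hf : ends f = s(a₁, u))
    (hleaf : ∀ e, a₁ ∈ ends e → e = f) (h1u : a₁ ≠ u) (h12 : a₁ ≠ a₂) (h1c : a₁ ≠ c)
    (h1o : a₁ ≠ o) (h1b : a₁ ≠ b) (hp : IsProbVec p)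
    (hP : ∀ e y z, ends e = s(y, z) → y ∈ P → z ∈ P ∨ z = u ∨ z = a₂ ∨ z = o)
    (hoff : (∀ ω e, e ∈ touches ends P → off ω e = false) ∧ (∀ ω e, e ∉ touches ends P → off ω e = ω e))
    (hinn : (∀ ω e, e ∈ touches ends P → inn ω e = ω e) ∧ (∀ ω e, e ∉ touches ends P → inn ω e = false))
    (hu : u ∉ P) (ha : a₂ ∉ P) (ho : o ∉ P) (hc : c ∉ P) (hb : b ∈ P)
    (h3 : HCov p ends o u a₂ c b) : HCov p ends o a₁ a₂ c b :=
  HCov_root_leaf_u_of p ends hp hf hleaf h1u h12 h1c h1o h1b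
    (T2_nonneg_pocketO p hp hP hoff hinn hu ha ho hc hb) h3

end PocketJoint

end RootLeafU

end Summit.Ventures.PercRepro2
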